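import Summits.Parity.GeneralizedHardyLittlewood.Theorems.DicksonFibrationDimOneStubPrimeSieveAux1
import Summits.Parity.GeneralizedHardyLittlewood.Theorems.DicksonFibrationDimOneStubPrimeSieveAux2
import Summits.Parity.GeneralizedHardyLittlewood.Theorems.DicksonFibrationDimOneStubSieveCountAux1
import Summits.Parity.GeneralizedHardyLittlewood.Theorems.LeeYangFibresAbsoluteUpgradeSinglesDecayPrep
import Literature.NumberTheory.Sieve.HeathBrownCubicFLSequencesA
import HarnessLib

/-!
# Route `DicksonFibration`, crux `DimOne` (stmt-Parity-0819), line `birth` (sieve-model reshape):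
# helper file 3 for the stub `stub_primeSieve` — the main term, the sieve dimension, and the
# obstructed case

Tools for the registered stub `stub_primeSieve : PrimeSieve` (file
`Theorems/DicksonFibrationDimOneStubPrimeSieve.lean`), continuing helper file 2
(`Theorems/DicksonFibrationDimOneStubPrimeSieveAux2.lean`):

* `weight_pow_mul_size_mul_prod_eq` — **the main terms agree EXACTLY**:
  `(P/φ(P))^t · (|a|/φ(|a|)) · ∏_{p<z} (1 − g_p) = ∏_{p ≤ n} β_p(Ψ)` for a system of `t + 1` forms,
  `z = n + 1`, `P = P(z)` (`P/φ(P) = ∏_{p<z} p/(p−1)`, `|a|/φ(|a|) = ∏_{p ∣ a} p/(p−1)`, the local identity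
  of helper file 2, and `β_p = p⁻¹ (p/(p−1))^{t+1} (p − ω_{F_Ψ}(p))`);
* `isCoprime_of_unobstructed` (no local obstruction forces `(a_i, b_i) = 1`) and
  `hasSieveDimension_density` — off the local obstructions the density `g` satisfies `Ω(2(L + t))` with a
  constant depending on `L, t` only (`g_p ≤ (L+t)/(p−1)`, `1 − g_p ≥ 1/p`; tree
  `CubicSieve.hasSieveDimension_of_le_div`);
* the OBSTRUCTED case: `dvd_form_of_obstructed`, `sifted_sum_le_of_obstructed` (the one-prime sifted sum
  only carries powers of the obstructing prime, `≤ (log x/log 2 + 1) log x`) and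
  `singularProductPartial_eq_zero_of_obstructed` (registered sub-goal; `β_p = 0`).

References: B. Green, T. Tao, Ann. of Math. 171 (2010), (1.6)–(1.7) and Lemma 1.3 [GreenTao2010];
H. Halberstam, H.-E. Richert, *Sieve Methods* (1974), Ch. 2 [HalberstamRichert1974].
-/

noncomputable section

open scoped BigOperators Classical
open Finset Polynomial Literature.NumberTheory.Sieve
open Summit.Parity.GeneralizedHardyLittlewood.Theorems.AbsoluteUpgrade

namespace Summit.Parity.GeneralizedHardyLittlewood.Cruxes.DimOne.BirthSieve

section Local

variable {t : ℕ}

/-- **The main terms agree EXACTLY.** With `z = n + 1`, `P = P(z) = ∏_{p ≤ n} p`, `a = a_i`,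
`(a_i, b_i) = 1` and `|a_i| ≤ n`:
`(P/φ(P))^t · (|a|/φ(|a|)) · ∏_{p<z} (1 − g_p) = ∏_{p ≤ n} β_p(Ψ)` for a system `Ψ` of `t + 1` forms
(`P/φ(P) = ∏_{p<z} p/(p−1)`, `|a|/φ(|a|) = ∏_{p ∣ a} p/(p−1)`, the local identity
`λ_p (1 − g_p) = (p − ω_{F_Ψ}(p))/(p−1)`, and `β_p = p⁻¹ (p/(p−1))^{t+1} (p − ω_{F_Ψ}(p))`).
[cite: GreenTao2010, (1.6)–(1.7)] -/
theorem weight_pow_mul_size_mul_prod_eq (Ψ : Fin (t + 1) → AffLinForm 1) (i : Fin (t + 1))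
    {g : ArithmeticFunction ℝ}
    (hg : ∀ d : ℕ, d ≠ 0 → g d = ∏ p ∈ d.primeFactors,
      (#((rootsMod (sysPoly (Fin.removeNth i Ψ)) p).filter
          (fun s : ℕ => Int.gcd ((Ψ i).coeff 0 * s + (Ψ i).const) p = 1)) : ℝ) /
        (if (p : ℤ) ∣ (Ψ i).coeff 0 then (p : ℝ) else (p : ℝ) - 1))
    (hab : IsCoprime ((Ψ i).coeff 0) (Ψ i).const) (ha : (Ψ i).coeff 0 ≠ 0) {n : ℕ}
    (han : ((Ψ i).coeff 0).natAbs ≤ n) :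
    ((primesProdBelow ((n + 1 : ℕ) : ℝ) : ℝ) /
          (Nat.totient (primesProdBelow ((n + 1 : ℕ) : ℝ)) : ℝ)) ^ t *
        ((((Ψ i).coeff 0).natAbs : ℝ) / (Nat.totient ((Ψ i).coeff 0).natAbs : ℝ)) *
          ∏ p ∈ Nat.primesBelow ⌈((n + 1 : ℕ) : ℝ)⌉₊, (1 - g p) =
      singularProductPartial Ψ n := by
  set a := (Ψ i).coeff 0 with hadef
  set S := Nat.primesBelow (n + 1) with hS
  have hceil : ⌈((n + 1 : ℕ) : ℝ)⌉₊ = n + 1 := Nat.ceil_natCast _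
  rw [hceil]
  -- `P/φ(P) = ∏_{p<z} (1 − 1/p)⁻¹`
  have hW : (primesProdBelow ((n + 1 : ℕ) : ℝ) : ℝ) /
      (Nat.totient (primesProdBelow ((n + 1 : ℕ) : ℝ)) : ℝ) = ∏ p ∈ S, (1 - (p : ℝ)⁻¹)⁻¹ := by
    have h := totient_primesProdBelow_div ((n + 1 : ℕ) : ℝ)
    rw [hceil] at h
    rw [← inv_div, h, Finset.prod_inv_distrib]
  -- `|a|/φ(|a|) = ∏_{p<z} λ_p`
  have hane : a.natAbs ≠ 0 := Int.natAbs_ne_zero.mpr ha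
  have hφ : ((a.natAbs : ℕ) : ℝ) / (Nat.totient a.natAbs : ℝ) =
      ∏ p ∈ a.natAbs.primeFactors, (1 - (p : ℝ)⁻¹)⁻¹ := by
    -- `φ(n) = n ∏_{p ∣ n} (1 − 1/p)`
    have h := Nat.totient_eq_mul_prod_factors a.natAbs
    have h' := congrArg (fun q : ℚ => (q : ℝ)) h
    push_cast at h'
    have hn0 : ((a.natAbs : ℕ) : ℝ) ≠ 0 := by exact_mod_cast hane
    rw [h', Finset.prod_inv_distrib, div_mul_eq_div_div, div_self hn0, one_div]
  have hA : ((a.natAbs : ℕ) : ℝ) / (Nat.totient a.natAbs : ℝ) =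
      ∏ p ∈ S, (if (p : ℤ) ∣ a then (1 - (p : ℝ)⁻¹)⁻¹ else 1) := by
    rw [hφ, ← Finset.prod_filter]
    refine Finset.prod_congr ?_ fun _ _ => rfl
    ext p
    rw [Nat.mem_primeFactors, hS, Finset.mem_filter, Nat.mem_primesBelow, Int.natCast_dvd]
    constructor
    · rintro ⟨hp, hpa, -⟩
      exact ⟨⟨Nat.lt_succ_of_le ((Nat.le_of_dvd (Nat.pos_of_ne_zero hane) hpa).trans han), hp⟩, hpa⟩
    · rintro ⟨⟨-, hp⟩, hpa⟩
      exact ⟨hp, hpa, hane⟩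
  rw [hW, hA, ← Finset.prod_pow, ← Finset.prod_mul_distrib, ← Finset.prod_mul_distrib,
    singularProductPartial, Nat.primesLE, ← hS]
  refine Finset.prod_congr rfl fun p hp => ?_
  have hpp : p.Prime := Nat.prime_of_mem_primesBelow hp
  haveI := Fact.mk hpp
  have hp2 : (2 : ℝ) ≤ p := by exact_mod_cast hpp.two_le
  have hp1 : (p : ℝ) - 1 ≠ 0 := by linarith
  have hp0 : (p : ℝ) ≠ 0 := by linarith
  have hloc := lambda_mul_one_sub_density Ψ i hg hpp hab
  have hsum := rootCount_add_goodCount Ψ hpp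
  have hG : (goodCount Ψ p : ℝ) = p - polyRootCountMod ![sysPoly Ψ] p := by
    have h := congrArg (fun m : ℕ => (m : ℝ)) hsum
    push_cast at h
    linarith
  have hinv : (1 - (p : ℝ)⁻¹)⁻¹ = p / (p - 1) := by
    field_simp
  rw [← hadef] at hloc
  rw [localFactor_prime, pow_one, hG, hinv, mul_assoc, hloc, pow_succ]
  have e : ((p : ℝ))⁻¹ * ((p : ℝ) / (p - 1)) = 1 / ((p : ℝ) - 1) := by field_simp
  calc ((p : ℝ) / (p - 1)) ^ t * (((p : ℝ) - polyRootCountMod ![sysPoly Ψ] p) / (p - 1))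
      = ((p : ℝ) / (p - 1)) ^ t * ((p : ℝ) - polyRootCountMod ![sysPoly Ψ] p) * (1 / ((p : ℝ) - 1)) := by
        ring
    _ = ((p : ℝ) / (p - 1)) ^ t * ((p : ℝ) - polyRootCountMod ![sysPoly Ψ] p) *
          (((p : ℝ))⁻¹ * ((p : ℝ) / (p - 1))) := by rw [e]
    _ = _ := by ring

/-- **No local obstruction forces `(a_i, b_i) = 1`**: if a prime `p` divided `a_i` and `b_i`, every
residue would be a root of `F_Ψ` modulo `p`. [folklore] -/
theorem isCoprime_of_unobstructed (Ψ : Fin (t + 1) → AffLinForm 1) (i : Fin (t + 1))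
    (hobs : ∀ p : ℕ, p.Prime → polyRootCountMod ![sysPoly Ψ] p < p) :
    IsCoprime ((Ψ i).coeff 0) (Ψ i).const := by
  by_contra h
  rw [Int.isCoprime_iff_gcd_eq_one] at h
  set p := (Int.gcd ((Ψ i).coeff 0) (Ψ i).const).minFac with hp
  have hpp : p.Prime := Nat.minFac_prime h
  have hpg : (p : ℤ) ∣ (Int.gcd ((Ψ i).coeff 0) (Ψ i).const : ℤ) :=
    Int.natCast_dvd_natCast.mpr (Nat.minFac_dvd _)
  have hpa : (p : ℤ) ∣ (Ψ i).coeff 0 := hpg.trans (Int.gcd_dvd_left _ _)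
  have hpb : (p : ℤ) ∣ (Ψ i).const := hpg.trans (Int.gcd_dvd_right _ _)
  have hall : rootsMod (sysPoly Ψ) p = range p := by
    refine Finset.filter_true_of_mem fun s _ => ?_
    rw [sysPoly_eq_mul Ψ i, Polynomial.eval_mul]
    refine dvd_mul_of_dvd_left ?_ _
    simp only [eval_add, eval_mul, eval_C, eval_X]
    exact dvd_add (dvd_mul_of_dvd_left hpa _) hpb
  have := hobs p hpp
  rw [← card_rootsMod, hall, Finset.card_range] at this
  exact lt_irrefl _ this

/-- **Sieve dimension of the density `g`.** Off the local obstructions (`ω_{F_Ψ}(p) < p` for all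
`p`) and with `|a_k| ≤ L` for all `k`, the density of the weighted sequence satisfies `Ω(2(L + t))`
with a constant depending on `L, t` only: `g_p ≤ (L + t)/(p − 1) ≤ 2(L + t)/p` (at most
`ω_{F_{Ψ₋ᵢ}}(p) ≤ L + t` good classes) and `1 − g_p ≥ 1/p` (the local identity), so `g_p ≤ 1 − 1/(2(L+t)+2)`.
[cite: HalberstamRichert1974, Ch. 2 (Ω₂(κ))] -/
theorem hasSieveDimension_density {Ψ : Fin (t + 1) → AffLinForm 1} (hΨ : IsNondegenerateSystem Ψ)
    {L : ℕ} (haL : ∀ k, ((Ψ k).coeff 0).natAbs ≤ L) (i : Fin (t + 1))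
    (hobs : ∀ p : ℕ, p.Prime → polyRootCountMod ![sysPoly Ψ] p < p) {g : ArithmeticFunction ℝ}
    (hg : ∀ d : ℕ, d ≠ 0 → g d = ∏ p ∈ d.primeFactors,
      (#((rootsMod (sysPoly (Fin.removeNth i Ψ)) p).filter
          (fun s : ℕ => Int.gcd ((Ψ i).coeff 0 * s + (Ψ i).const) p = 1)) : ℝ) /
        (if (p : ℤ) ∣ (Ψ i).coeff 0 then (p : ℝ) else (p : ℝ) - 1)) :
    HasSieveDimension g ((2 * (L + t) : ℕ) : ℝ)
      (Real.exp (((2 * (L + t) : ℕ) : ℝ) * (9 / 2 + 6 / Real.log 2) +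
        ((2 * (L + t) : ℕ) : ℝ) ^ 2 / (1 / ((2 * (L + t) : ℕ) + 2 : ℝ)))) := by
  set a := (Ψ i).coeff 0 with hadef
  set b := (Ψ i).const with hbdef
  set F := sysPoly (Fin.removeNth i Ψ) with hF
  set B : ℕ := L + t with hB
  have hab : IsCoprime a b := isCoprime_of_unobstructed Ψ i hobs
  have hΨ' : IsNondegenerateSystem (Fin.removeNth i Ψ) :=
    ⟨fun k => hΨ.1 (i.succAbove k), fun k l hkl a' b' h =>
      hΨ.2 (i.succAbove k) (i.succAbove l) (fun e => hkl (Fin.succAbove_right_injective e)) a' b' h⟩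
  have haL' : ∀ k, ((Fin.removeNth i Ψ k).coeff 0).natAbs ≤ L := fun k => haL (i.succAbove k)
  have hδ : (0 : ℝ) < 1 / ((2 * B : ℕ) + 2 : ℝ) := by positivity
  refine Literature.NumberTheory.Sieve.CubicSieve.hasSieveDimension_of_le_div hδ fun p hp => ?_
  have hp2 : (2 : ℝ) ≤ p := by exact_mod_cast hp.two_le
  have hp1 : (0 : ℝ) < (p : ℝ) - 1 := by linarith
  have hp0 : (0 : ℝ) < p := by linarith
  -- the good classes: at most `ω_F(p) ≤ L + t`
  have hgc : (#((rootsMod F p).filter (fun s : ℕ => Int.gcd (a * s + b) p = 1)) : ℝ) ≤ B := by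
    have h1 : #((rootsMod F p).filter (fun s : ℕ => Int.gcd (a * s + b) p = 1)) ≤ #(rootsMod F p) :=
      Finset.card_le_card (Finset.filter_subset _ _)
    rw [card_rootsMod] at h1
    exact_mod_cast h1.trans (rootCount_le_add hΨ' haL' hp)
  have hθ : (p : ℝ) - 1 ≤ (if (p : ℤ) ∣ a then (p : ℝ) else (p : ℝ) - 1) := by
    split_ifs <;> linarith
  have hθ0 := theta_pos a hp
  have hgp : g p = (#((rootsMod F p).filter (fun s : ℕ => Int.gcd (a * s + b) p = 1)) : ℝ) /
      (if (p : ℤ) ∣ a then (p : ℝ) else (p : ℝ) - 1) := density_prime hg hp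
  have hg0 : 0 ≤ g p := by rw [hgp]; positivity
  -- `g_p ≤ B/(p − 1) ≤ 2B/p`
  have hgB : g p ≤ (B : ℝ) / ((p : ℝ) - 1) := by
    rw [hgp]
    calc _ ≤ (B : ℝ) / (if (p : ℤ) ∣ a then (p : ℝ) else (p : ℝ) - 1) :=
          div_le_div_of_nonneg_right hgc hθ0.le
      _ ≤ (B : ℝ) / ((p : ℝ) - 1) := div_le_div_of_nonneg_left (Nat.cast_nonneg B) hp1 hθ
  have hgA : g p ≤ ((2 * B : ℕ) : ℝ) / p := by
    refine hgB.trans ?_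
    rw [div_le_div_iff₀ hp1 hp0]
    push_cast
    nlinarith [Nat.cast_nonneg (α := ℝ) B]
  -- `1 − g_p ≥ 1/p` (the local identity and `ω_{F_Ψ}(p) ≤ p − 1`)
  have h1g : (1 : ℝ) / p ≤ 1 - g p := by
    have hloc := lambda_mul_one_sub_density Ψ i hg hp hab
    have hω : (polyRootCountMod ![sysPoly Ψ] p : ℝ) ≤ p - 1 := by
      have := hobs p hp
      have h' : polyRootCountMod ![sysPoly Ψ] p + 1 ≤ p := this
      have h'' : ((polyRootCountMod ![sysPoly Ψ] p + 1 : ℕ) : ℝ) ≤ p := by exact_mod_cast h'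
      push_cast at h''
      linarith
    have hR : (1 : ℝ) / (p - 1) ≤ ((p : ℝ) - polyRootCountMod ![sysPoly Ψ] p) / (p - 1) :=
      div_le_div_of_nonneg_right (by linarith) hp1.le
    have hlamle : (if (p : ℤ) ∣ a then (p : ℝ) / (p - 1) else 1) ≤ (p : ℝ) / (p - 1) := by
      split_ifs
      · exact le_rfl
      · rw [le_div_iff₀ hp1]; linarith
    have hlam0 : 0 < (if (p : ℤ) ∣ a then (p : ℝ) / (p - 1) else 1) := by
      split_ifs
      · positivity
      · exact one_pos
    have h1g0 : 0 ≤ 1 - g p := by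
      by_contra hneg
      push Not at hneg
      have : (if (p : ℤ) ∣ a then (p : ℝ) / (p - 1) else 1) * (1 - g p) < 0 :=
        mul_neg_of_pos_of_neg hlam0 hneg
      have h2 : (0 : ℝ) < 1 / (p - 1) := by positivity
      linarith
    -- `1/(p−1) ≤ λ_p (1 − g_p) ≤ (p/(p−1)) (1 − g_p)`
    have h3 : (1 : ℝ) / (p - 1) ≤ (p : ℝ) / (p - 1) * (1 - g p) := by
      calc (1 : ℝ) / (p - 1) ≤ (if (p : ℤ) ∣ a then (p : ℝ) / (p - 1) else 1) * (1 - g p) := by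
            rw [hloc]; exact hR
        _ ≤ (p : ℝ) / (p - 1) * (1 - g p) := mul_le_mul_of_nonneg_right hlamle h1g0
    rw [div_mul_eq_mul_div, le_div_iff₀ hp1, div_mul_cancel₀ _ hp1.ne'] at h3
    rw [div_le_iff₀ hp0]
    linarith
  refine ⟨hg0, hgA, ?_⟩
  -- `g_p ≤ 1 − δ`
  by_cases hpB : (p : ℝ) ≤ (2 * B : ℕ) + 2
  · have : 1 / ((2 * B : ℕ) + 2 : ℝ) ≤ (1 : ℝ) / p := div_le_div_of_nonneg_left zero_le_one hp0 hpB
    linarith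
  · push Not at hpB
    have hB0 : (0 : ℝ) ≤ B := Nat.cast_nonneg B
    have h2B : ((2 * B : ℕ) : ℝ) = 2 * B := by push_cast; ring
    rw [h2B] at hpB ⊢
    -- `g_p ≤ B/(p−1) ≤ B/(2B+1) ≤ 1/2 ≤ 1 − 1/(2B+2)`
    have h4 : (B : ℝ) / ((p : ℝ) - 1) ≤ 1 / 2 := by
      rw [div_le_iff₀ hp1]; linarith
    have h5 : 1 / (2 * (B : ℝ) + 2) ≤ 1 / 2 := div_le_div_of_nonneg_left zero_le_one two_pos (by linarith)
    linarith

end Local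

/-! ### The obstructed case -/

section Cases

open Filter

variable {t : ℕ}

/-- If the sifted `m` has all `ψ_k(m)`, `k ≠ i`, coprime to `P ∋ p` while every residue is a root of
`F_Ψ` modulo `p`, then `p ∣ ψ_i(m)`. [folklore] -/
theorem dvd_form_of_obstructed (Ψ : Fin t → AffLinForm 1) (i : Fin t) {p : ℕ} (hp : p.Prime)
    (hρ : polyRootCountMod ![sysPoly Ψ] p = p) {P : ℕ} (hpP : p ∣ P) {m : ℤ}
    (hm : ∀ k, k ≠ i → Int.gcd ((Ψ k).eval (fun _ => m)) P = 1) :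
    (p : ℤ) ∣ (Ψ i).eval (fun _ => m) := by
  have h1 : (p : ℤ) ∣ (sysPoly Ψ).eval m := dvd_eval_of_rootCount_eq _ hp.pos hρ m
  rw [sysPoly_eval] at h1
  obtain ⟨k, -, hk⟩ := ((Nat.prime_iff_prime_int.mp hp).dvd_finsetProd_iff _).mp h1
  by_cases hki : k = i
  · rwa [hki] at hk
  · exfalso
    have h2 := hm k hki
    have h3 : p ∣ Int.gcd ((Ψ k).eval (fun _ => m)) P := by
      rw [Int.gcd_eq_natAbs, Int.natAbs_natCast]
      exact Nat.dvd_gcd (Int.natCast_dvd.mp hk) hpP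
    rw [h2] at h3
    exact hp.one_lt.ne' (Nat.dvd_one.mp h3)

/-- **The obstructed case.** If every residue is a root of `F_Ψ` modulo a prime `p ∣ P`, the one-prime
sifted sum only carries the powers of `p` among the values of `ψ_i`:
`Σ_{m ∈ I : (ψ_k(m), P) = 1 ∀ k ≠ i} Λ(ψ_i(m)) ≤ (log x/log 2 + 1) log x` (values of `ψ_i` in `[1, x]`).
[folklore] -/
theorem sifted_sum_le_of_obstructed {Ψ : Fin t → AffLinForm 1} (hΨ : IsNondegenerateSystem Ψ)
    (i : Fin t) {p : ℕ} (hp : p.Prime) (hρ : polyRootCountMod ![sysPoly Ψ] p = p) {P : ℕ}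
    (hpP : p ∣ P) (I : Finset ℤ) {x : ℝ} (hx : 1 ≤ x)
    (hpos : ∀ m ∈ I, 1 ≤ (Ψ i).coeff 0 * m + (Ψ i).const)
    (hle : ∀ m ∈ I, (((Ψ i).coeff 0 * m + (Ψ i).const : ℤ) : ℝ) ≤ x) :
    ∑ m ∈ I.filter (fun m : ℤ => ∀ k, k ≠ i → Int.gcd ((Ψ k).eval (fun _ => m)) P = 1),
        intVonMangoldt ((Ψ i).coeff 0 * m + (Ψ i).const) ≤
      (Real.log x / Real.log 2 + 1) * Real.log x := by
  have ha0 : (Ψ i).coeff 0 ≠ 0 := coeff_ne_zero_of_nondegenerate hΨ i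
  have hsub : I.filter (fun m : ℤ => ∀ k, k ≠ i → Int.gcd ((Ψ k).eval (fun _ => m)) P = 1) ⊆
      I.filter (fun m : ℤ => (p : ℤ) ∣ (Ψ i).coeff 0 * m + (Ψ i).const) := by
    intro m hm
    rw [Finset.mem_filter] at hm
    refine Finset.mem_filter.mpr ⟨hm.1, ?_⟩
    have h := dvd_form_of_obstructed Ψ i hp hρ hpP hm.2
    rwa [DimOne.eval_eq] at h
  exact (Finset.sum_le_sum_of_subset_of_nonneg hsub fun m _ _ => ArithmeticFunction.vonMangoldt_nonneg).trans
    (sum_intVonMangoldt_filter_dvd_le ha0 hp I hx hpos hle)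

/-- A local obstruction at `p ≤ n` kills the partial singular product `∏_{q ≤ n} β_q`. [folklore] -/
theorem singularProductPartial_eq_zero_of_obstructed : ∀ {t : ℕ} (Ψ : Fin t → Literature.NumberTheory.Sieve.AffLinForm 1) {p : ℕ}, p.Prime → Literature.NumberTheory.Sieve.polyRootCountMod ![Summit.Parity.GeneralizedHardyLittlewood.Theorems.AbsoluteUpgrade.sysPoly Ψ] p = p → ∀ {n : ℕ}, p ≤ n → Literature.NumberTheory.Sieve.singularProductPartial Ψ n = 0 := by
  intro t Ψ p hp hρ n hpn
  have hβ : localFactor Ψ p = 0 := by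
    have h := one_sub_rootCount_div_eq Ψ hp
    rw [hρ, div_self (by exact_mod_cast hp.ne_zero : (p : ℝ) ≠ 0), sub_self] at h
    have hpos : 0 < (1 - (p : ℝ)⁻¹) ^ t := by
      refine pow_pos (sub_pos.mpr (inv_lt_one_of_one_lt₀ ?_)) _
      exact_mod_cast hp.one_lt
    rcases mul_eq_zero.mp h.symm with h1 | h1
    · exact h1
    · exact absurd h1 hpos.ne'
  exact Finset.prod_eq_zero (Nat.mem_primesLE.mpr ⟨hpn, hp⟩) hβ

end Cases

end Summit.Parity.GeneralizedHardyLittlewood.Cruxes.DimOne.BirthSieve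

end
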